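import Literature.NumberTheory.EllipticCurves.ZpExtensionEisensteinDVRSettingH5bBadPlacesProofs
import Literature.NumberTheory.Automorphic.GaloisActionPlaces
import HarnessLib

/-!
# Howard's H.5(b) for the curve's Eisenstein setting at the places `v ∈ S ∖ {v ∣ p}`, UNIFORMLY for `m ≫ 0` — one threshold
# for all such `v` and all conjugation data (theorems only)

`Proofs` file (theorems only; no definition, no named fact, no instance, no `sorry`).  Topic `NumberTheory/EllipticCurves`
(D1 road of cell `pub/bsd-print-x9`, seat `bsd-line-x10b-p1-w8` g3, the `k = 0` assembler lineage; sequel of x9-p1-w3's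
`ZpExtensionEisensteinDVRSettingH5bBadPlacesProofs` (`eisensteinDVRSetting_h5b_clause_zero_of_mem_of_not_decomp_le`, one place,
one conjugation datum fixed BEFORE the threshold) in the quantifier discipline of D1's letter `Stmt.h5bAtS` (threshold `m₅`
first, then ALL the data of the Eisenstein setting — prime set `𝓛`, `jbar`, the conjugation datum, the H.4 data, the
finite–singular slots — then `∀ v ∈ S`), on the model of the LEAD's `v ∤ p` half of `Stmt.h4AtS`
(`ZpExtensionEisensteinDVRSettingH4BadPlacesUniformProofs`, `choose!` + `Finset.sup`).

For `S ⊇ {v ∣ p} ∪ {bad}` whose places prime to `p` are finitely decomposed in `K_∞/K` (`hdec`; on the μ-letter's frames: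
x9-p2's `ZpExtension.not_decomp_le_kerSubgroup_of_natCast_mem`, from (Heeg)), the per-place inputs of the level-`0` clause —
(UT) `p^{8N_w} · H¹(K_w, E_K[p^j] ⊗ A_{m,j}(ψ)) = 0` for all `j` once `m > 2N_w` (x9-p1-w4's
`exists_forall_pow_smul_galoisCohomology_one_toLocal_eq_zero_uniform`) and (SB) `[T]^{m-1}` kills the local invariants once
`m > 2p^{s_w}`, `κ(Γ_{K_w}) ∋ p^{s_w}` (x9-p1-w3's `ZpExtension.mk_X_pow_pred_smul_eq_zero_of_forall_toLocal`) — depend on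
`w` and `κ` only; taking the maximum of `2N_w + 2p^{s_w}` over the finitely many `w ∈ S`:
* **`WeierstrassCurve.eisensteinDVRSetting_exists_forall_h5b_clause_zero_of_not_mem`** — THERE IS `m₁` such that for every
  `m > m₁`, every `𝓛`, `jbar`, every conjugation datum `cd` for which `κ` is anticyclotomic (`κ(τ⁻¹ g τ) = −κ(g)`) and `S` is
  `cd.σ`-stable, every H.4 data `D` and slots `fs`: the H.5(b) clause `(θ_v ∘ transport_v)(F̄_𝔮(σ v)) = F̄_𝔮(v)` holds at tower
  level `0` at EVERY `v ∈ S` with `v ∤ p` (LITERALLY the conclusion shape of `eisensteinDVRSetting_h5b_clause_zero_of_mem`; all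
  levels `k` by x10b-p1-w8's `eisensteinDVRSetting_h5b_clause_of_zero`).
The places above `p` are NOT covered here.  No summit statement is proved; BSD is not proved by any of this.

References: [Howard2004HeegnerKolyvagin] §1.3 H.5(b), §2.2, Def. 3.1.2 (arXiv:1202.6340 p. 7 L96–97); [Brink2007] Thm. 2;
[MazurRubinMemoirs2004] Def. 1.1.1; [MilneADT2006] I Thm. 2.8.
-/

set_option autoImplicit false

noncomputable section

open Function NumberField IsDedekindDomain Field
open scoped NumberField ContRepresentation TensorProduct Classical Pointwise

namespace WeierstrassCurve

open Literature.NumberTheory.EllipticCurves Literature.NumberTheory.GaloisRepresentations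
open Literature.NumberTheory.GaloisRepresentations.DiscreteGaloisModule
open Literature.NumberTheory.GaloisCohomology.Howard2004
open Literature.NumberTheory.EllipticCurves.ZpExtension (EisensteinLevel)
open Literature.NumberTheory.EllipticCurves.IwasawaAlgebra
open Literature.NumberTheory.Automorphic

variable {K : Type} [Field K] [NumberField K] (W : WeierstrassCurve ℚ) [W.IsElliptic] {p : ℕ} [hp : Fact p.Prime]
  (κ : ZpExtension K p) (S : Finset (HeightOneSpectrum (𝓞 K)))
  (hpS : ∀ v : HeightOneSpectrum (𝓞 K), ((p : ℕ) : 𝓞 K) ∈ v.asIdeal → v ∈ S)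
  (hbad : ∀ v : HeightOneSpectrum (𝓞 K), v ∉ S → ((p : ℕ) : 𝓞 K) ∉ v.asIdeal → (W.baseChange K).HasGoodReductionAt v)

set_option synthInstance.maxHeartbeats 80000 in
/-- **H.5(b) at the places `v ∈ S ∖ {p}` for the curve's Eisenstein setting, with ONE threshold for all of them and for all
the remaining data.**  If every `v ∈ S` with `v ∤ p` has decomposition group not contained in `ker κ`, there is `m₁` such that
for all `m > m₁`, every admissible prime set `𝓛`, every `jbar`, every conjugation datum `cd` with `κ(τ⁻¹ g τ) = −κ(g)` and
`cd.σ • S ⊆ S`, every H.4 data `D` and finite–singular slots `fs`, and every `v ∈ S` with `v ∤ p`: at tower level `0`,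
`(θ_v ∘ transport_v)(F̄_𝔮(σ v)) = F̄_𝔮(v)` — the `v ∤ p` summands of the `hfin` hypothesis of `eisensteinDVRSetting_h5b_of`
at `k = 0`.  Inputs per place: (UT) and (SB), fed into `eisensteinDVRSetting_h5b_clause_zero_of_mem`.
[cite: Howard2004HeegnerKolyvagin, §1.3 H.5(b) (arXiv:1202.6340 p. 7 L96–97), §2.2, Def. 3.1.2]
[cite: MazurRubinMemoirs2004, Def. 1.1.1] [cite: Brink2007, Thm. 2] -/
theorem eisensteinDVRSetting_exists_forall_h5b_clause_zero_of_not_mem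
    (hdec : ∀ v ∈ S, ((p : ℕ) : 𝓞 K) ∉ v.asIdeal → ¬ (GreenbergSelmer.decomp v ≤ κ.kerSubgroup)) :
    ∃ m₁ : ℕ, ∀ (m : ℕ) (hm : 1 ≤ m), m₁ < m →
      ∀ (L : Set (HeightOneSpectrum (𝓞 K)))
        (hL : letI := IwasawaAlgebra.isLocalRing_quotient_X_pow_add_C p hm
          L ⊆ (W.eisensteinTower κ hm).degreeTwoPrimes p)
        (hLS : ∀ v ∈ L, v ∉ S) (jbar : AlgebraicClosure K →+* ℂ) (cd : ConjugationDatum K)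
        (D : letI := IwasawaAlgebra.isLocalRing_quotient_X_pow_add_C p hm
          ∀ k, DualityDatum p cd ((W.eisensteinTower κ hm).ρ k) (IwasawaAlgebra.EisensteinCoeff p m (k + 1)))
        (fs : letI := IwasawaAlgebra.isLocalRing_quotient_X_pow_add_C p hm
          ∀ (k : ℕ) (n : Finset (HeightOneSpectrum (𝓞 K))) (v : HeightOneSpectrum (𝓞 K)),
            galoisCohomology ((W.eisensteinLevelQuot κ hm k n).toLocal (Sum.inr v)) 1 →+
              SingularQuotient (GaloisRep.toLocal v (W.eisensteinLevelQuot κ hm k n)) ⊗[ℤ] Gell v),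
        (∀ g : absoluteGaloisGroup K, (κ (cd.conj g)).toAdd = -(κ g).toAdd) →
        (∀ v ∈ S, cd.σ • v ∈ S) →
        ∀ v ∈ S, ((p : ℕ) : 𝓞 K) ∉ v.asIdeal →
      letI := IwasawaAlgebra.isDomain_quotient_X_pow_add_C p hm
      letI := IwasawaAlgebra.isDiscreteValuationRing_quotient_X_pow_add_C p hm
      haveI := IwasawaAlgebra.EisensteinCoeff.isLocalRing_succ p hm
      letI := IwasawaAlgebra.EisensteinCoeff.algebraOfSpecSucc p m
      haveI := W.isScalarTower_algebraOfSpecSucc (K := K) (p := p) (m := m)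
      letI := W.residueModuleSucc (K := K) (p := p) hm
      AddSubgroup.map
          (((W.residualTauGeomTorsion (p := p) cd hm (k := 0 + 1) (Nat.succ_pos 0)).thetaH1 (Sum.inr v)).comp
            (cd.transportH1 ((W.baseChange K).torsionGaloisModule (p : ℤ)) v))
          (((W.isQuotientBy_eisensteinDVRSetting_πbar κ hm S hpS hbad L hL hLS jbar cd D fs 0).propagateStructure
            (W.eisensteinTowerTriple κ hm S hpS hbad L hL hLS 0).cond) (Sum.inr (cd.σ • v))) =
        ((W.isQuotientBy_eisensteinDVRSetting_πbar κ hm S hpS hbad L hL hLS jbar cd D fs 0).propagateStructure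
          (W.eisensteinTowerTriple κ hm S hpS hbad L hL hLS 0).cond) (Sum.inr v) := by
  classical
  -- (UT) per place: `p^{8N_v}` kills `H¹(K_v, E_K[p^j] ⊗ A_{m,j}(ψ))` for all `j` once `m > 2N_v`
  have hUT : ∀ v ∈ S, ((p : ℕ) : 𝓞 K) ∉ v.asIdeal →
      ∃ N : ℕ, 1 ≤ N ∧ ∀ (m : ℕ) (hm : 1 ≤ m), 2 * N < m → ∀ (j : ℕ)
        (x : galoisCohomology (GaloisRep.toLocal v
          (κ.eisensteinTwist ((W.baseChange K).torsionGaloisModule ((p : ℤ) ^ j)) hm j)) 1), p ^ (8 * N) • x = 0 :=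
    fun v hvS hpv ↦ exists_forall_pow_smul_galoisCohomology_one_toLocal_eq_zero_uniform v (W.baseChange K) κ hpv
      (hdec v hvS hpv)
  choose! Nv hNv using hUT
  -- (SB) per place: an element of the decomposition group on which `κ` is `p^{s_v}`
  have hSB : ∀ v ∈ S, ((p : ℕ) : 𝓞 K) ∉ v.asIdeal → ∃ s : ℕ, ∃ g₀ : absoluteGaloisGroup (v.adicCompletion K),
      (κ (absGaloisRestrict K (v.adicCompletion K) g₀)).toAdd = ((p ^ s : ℕ) : ℤ_[p]) := by
    intro v hvS hpv
    obtain ⟨h₁, hh₁⟩ := exists_apply_absGaloisRestrict_ne_one_of_not_decomp_le κ v (hdec v hvS hpv)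
    exact κ.exists_toAdd_apply_absGaloisRestrict_eq_pow (v.adicCompletion K) h₁ hh₁
  choose! sv hsv using hSB
  refine ⟨S.sup (fun v ↦ 2 * Nv v + 2 * p ^ sv v), fun m hm hm₁ L hL hLS jbar cd D fs hanti hSσ v hvS hpv ↦ ?_⟩
  -- `σ v ∈ S`, `σ v ∤ p`, and the four bounds `2N_v, 2N_{σv}, 2p^{s_v}, 2p^{s_{σv}} < m`
  have hσvS : cd.σ • v ∈ S := hSσ v hvS
  have hpσv : ((p : ℕ) : 𝓞 K) ∉ (cd.σ • v).asIdeal := by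
    intro h
    have hσp : cd.σ • (((p : ℕ) : 𝓞 K)) = ((p : ℕ) : 𝓞 K) := map_natCast (MulSemiringAction.toRingHom _ (𝓞 K) cd.σ) p
    rw [← hσp] at h
    exact hpv ((HeightOneSpectrum.smul_mem_smul_asIdeal_iff cd.σ v _).1 h)
  have hbv : 2 * Nv v + 2 * p ^ sv v < m :=
    lt_of_le_of_lt (Finset.le_sup (f := fun v ↦ 2 * Nv v + 2 * p ^ sv v) hvS) hm₁
  have hbσv : 2 * Nv (cd.σ • v) + 2 * p ^ sv (cd.σ • v) < m :=
    lt_of_le_of_lt (Finset.le_sup (f := fun v ↦ 2 * Nv v + 2 * p ^ sv v) hσvS) hm₁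
  -- the local data at the two places `w ∈ {v, σ v}`, read off the uniform bound
  have hloc : ∀ w ∈ ({v, cd.σ • v} : Set (HeightOneSpectrum (𝓞 K))),
      w ∈ S ∧ ((p : ℕ) : 𝓞 K) ∉ w.asIdeal ∧ 2 * Nv w + 2 * p ^ sv w < m ∧ Nv w ≤ Nv v + Nv (cd.σ • v) := by
    intro w hw
    rcases hw with hw | hw
    · rw [hw]
      exact ⟨hvS, hpv, hbv, Nat.le_add_right _ _⟩
    · rw [Set.mem_singleton_iff] at hw
      rw [hw]
      exact ⟨hσvS, hpσv, hbσv, Nat.le_add_left _ _⟩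
  refine W.eisensteinDVRSetting_h5b_clause_zero_of_mem κ hm S hpS hbad L hL hLS jbar cd D fs hanti hvS hpv hσvS hpσv
    (c := 8 * (Nv v + Nv (cd.σ • v))) (fun w hw j y ↦ ?_) (fun w hw j x hx ↦ ?_)
  · -- (UT)
    obtain ⟨hwS, hpw, hbw, hle⟩ := hloc w hw
    have h1 : p ^ (8 * Nv w) • y = 0 := (hNv w hwS hpw).2 m hm (by omega) j y
    obtain ⟨r, hr⟩ := Nat.exists_eq_add_of_le (Nat.mul_le_mul_left 8 hle)
    rw [hr, show 8 * Nv w + r = r + 8 * Nv w from Nat.add_comm _ _, pow_add, mul_smul, h1, smul_zero]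
  · -- (SB)
    obtain ⟨hwS, hpw, hbw, -⟩ := hloc w hw
    obtain ⟨g₀, hg₀⟩ := hsv w hwS hpw
    exact ZpExtension.mk_X_pow_pred_smul_eq_zero_of_forall_toLocal (E := W.baseChange K) (κ' := κ) (hm := hm)
      (w := w) hg₀ (by omega) j x hx

end WeierstrassCurve

end
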